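import Summits.Ventures.PercRepro.MSTightCompletionCoords
import Summits.Ventures.PercRepro.MSTightConjTTwinFree
import Summits.Ventures.PercRepro.MSTightConjTSing

/-!
# The `r`-free differences and the signability cells of a shape-A configuration, in coordinates

Dossier proofs/MINE1-theoremS.md, Addendum 57 §3 and Addendum 59 (2); HANDOFF §mine-1
gen 32 → 33, step (K4). In the coordinates of `MSTightCompletionCoords.lean` (`P = L ⊻ U`,
`F₀ = L ⊻ U₀`, `M = cM r F`, `N = cN r F = univ ∖ R̃`):

* the `r`-free differences are the product `X = D(P) = L ⊻ (M − U)`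
  (`mem_diffsX_iff_coords`: `w ∈ X ↔ r ∉ w ∧ w ∖ M ∈ L ∧ w ∩ M ∈ complWithin M U`);
* for an `r`-free member `s` and `u ∋ r` with `u₁ = u.erase r`: the C*-cells of `s` reduce to
  `u₁ ∖ s ∈ Y` (`cells_compl_iff_of_mem_part0`: the other cell `s ∖ u₁` is always an `r`-free
  difference), and the A-cells give `ū_N ∖ x_s ∈ L` and `M ∖ (y_s ∩ u_M) ∈ U`
  (`cL_of_cells`, `cU_of_cells`) — Addendum 57 §3's «`A(s) ⟺ y_s ∩ u_M ∈ L′ ∧ ū_N ∖ x_s ∈ L`».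
-/

namespace PercRepro.MSTight

open Finset
open scoped FinsetFamily

variable {α : Type*} [DecidableEq α] [Fintype α] {F : Finset (Finset α)} {r : α}

section DiffsX

/-- `N`: the coordinates outside the addable part of the completion. -/
def cN (r : α) (F : Finset (Finset α)) : Finset α := univ \ Rstar (completion0 r F)

/-- A member of `L` lies inside `N`. -/
theorem subset_cN_of_mem_cL {x : Finset α} (hx : x ∈ cL r F) : x ⊆ cN r F := subset_of_mem_cL hx

/-- `N` and `M` are disjoint. -/
theorem disjoint_cN_cM : Disjoint (cN r F) (cM r F) :=
  disjoint_of_subset_right cM_subset_Rstar sdiff_disjoint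

/-- `r ∉ N`. -/
theorem r_notMem_cN (hr : r ∈ Rstar (completion0 r F)) : r ∉ cN r F := fun h =>
  (mem_sdiff.1 h).2 hr

/-- For `r ∉ w`: `w ∖ M = w ∩ N`. -/
theorem sdiff_cM_eq_inter_cN {w : Finset α} (hrw : r ∉ w) : w \ cM r F = w ∩ cN r F := by
  rw [sdiff_cM_eq_sdiff_Rstar hrw]
  ext a
  simp only [cN, mem_sdiff, mem_inter, mem_univ, true_and]

/-- Every `r`-free set splits as its `N`-part and its `M`-part. -/
theorem inter_cN_union_inter_cM {w : Finset α} (hrw : r ∉ w) :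
    w ∩ cN r F ∪ w ∩ cM r F = w := by
  rw [← sdiff_cM_eq_inter_cN hrw, sdiff_union_inter]

/-- A difference of the trace is `(x_t ∖ x_s) ∪ (y_t ∖ y_s)`, with `x_t ∖ x_s ∈ L` and
`y_t ∖ y_s ∈ M − U`. -/
theorem mem_diffs_proj_iff_coords (htw : ∀ a b, Twin F a b → a = b)
    (hcore : ∀ a, ∃ t ∈ F, a ∉ t) (hC : Tight (completion0 r F)) {w : Finset α} :
    w ∈ proj r F \\ proj r F ↔
      r ∉ w ∧ w \ cM r F ∈ cL r F ∧ w ∩ cM r F ∈ complWithin (cM r F) (cU r F) := by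
  constructor
  · intro hw
    obtain ⟨t, ht, s, hs, rfl⟩ := mem_diffs.1 hw
    have hxt := sdiff_cM_mem_cL_of_mem_proj htw hcore hC ht
    have hyt := inter_cM_mem_cU_of_mem_proj htw hcore hC ht
    have hys := inter_cM_mem_cU_of_mem_proj htw hcore hC hs
    refine ⟨fun h => r_notMem_of_mem_proj ht (mem_sdiff.1 h).1, ?_, ?_⟩
    · exact isDownSet_cL htw hcore hC _ hxt _ (sdiff_subset_sdiff sdiff_subset (Subset.refl _))
    · refine mem_complWithin.2 ⟨s ∩ cM r F ∪ (cM r F \ (t ∩ cM r F)), ?_, ?_⟩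
      · exact isUpSetWithin_cU htw hcore hC _ hys _ (union_subset inter_subset_right sdiff_subset)
          subset_union_left
      · ext a
        simp only [mem_sdiff, mem_union, mem_inter, not_or, not_and]
        tauto
  · rintro ⟨hrw, hx, hz⟩
    obtain ⟨y, hy, hyz⟩ := mem_complWithin.1 hz
    have hyM := subset_cM_of_mem_cU hy
    have ht : w \ cM r F ∪ cM r F ∈ proj r F :=
      union_mem_proj htw hcore hC hx (cU0_subset_cU htw hcore hC (cM_mem_cU0 hcore))
    have hs : y ∈ proj r F := by
      have := union_mem_proj htw hcore hC (empty_mem_cL hcore) hy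
      rwa [empty_union] at this
    refine mem_diffs.2 ⟨_, ht, y, hs, ?_⟩
    have key : ∀ a, a ∈ cM r F → (a ∉ y ↔ a ∈ w) := by
      intro a haM
      constructor
      · intro hay
        have : a ∈ w ∩ cM r F := by
          rw [← hyz]
          exact mem_sdiff.2 ⟨haM, hay⟩
        exact (mem_inter.1 this).1
      · intro haw hay
        have : a ∈ cM r F \ y := by
          rw [hyz]
          exact mem_inter.2 ⟨haw, haM⟩
        exact (mem_sdiff.1 this).2 hay
    ext a
    simp only [mem_sdiff, mem_union]
    by_cases haM : a ∈ cM r F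
    · have := key a haM
      tauto
    · have : a ∉ y := fun hay => haM (hyM hay)
      tauto

/-- **The `r`-free differences in coordinates**: `w ∈ X ↔ r ∉ w ∧ w ∖ M ∈ L ∧ w ∩ M ∈ M − U`. -/
theorem mem_diffsX_iff_coords (htw : ∀ a b, Twin F a b → a = b)
    (hF : (F \\ F).card = F.card + 1) (hE : (∅ : Finset α) ∉ F) (hU : (univ : Finset α) ∉ F)
    (hcore : ∀ a, ∃ t ∈ F, a ∉ t) (hsupp : ∀ a, ∃ t ∈ F, a ∈ t) (hP : Tight (proj r F))
    (hC : Tight (completion0 r F)) {w : Finset α} :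
    w ∈ diffsX r F ↔
      r ∉ w ∧ w \ cM r F ∈ cL r F ∧ w ∩ cM r F ∈ complWithin (cM r F) (cU r F) := by
  rw [diffsX_eq_diffs_proj_of_twinFree htw hF hE hU hcore hsupp hP,
    mem_diffs_proj_iff_coords htw hcore hC]

omit [Fintype α] in
/-- An `r`-free set is a difference of `F` iff it is an `r`-free difference. -/
theorem mem_diffs_iff_mem_diffsX {w : Finset α} (hrw : r ∉ w) :
    w ∈ F \\ F ↔ w ∈ diffsX r F := by
  rw [mem_diffsX_iff]
  exact ⟨fun h => ⟨h, hrw⟩, fun h => h.1⟩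

end DiffsX

section Cells

variable {u : Finset α}

/-- For `v` with `v ∩ M ∈ U`: `(s ∖ v) ∩ M ∈ M − U` for every `r`-free set `s`
(`M ∖ (s ∖ v) ⊇ v ∩ M`). -/
theorem sdiff_inter_cM_mem_complWithin (htw : ∀ a b, Twin F a b → a = b)
    (hcore : ∀ a, ∃ t ∈ F, a ∉ t) (hC : Tight (completion0 r F)) {v : Finset α}
    (hv : v ∩ cM r F ∈ cU r F) (s : Finset α) :
    (s \ v) ∩ cM r F ∈ complWithin (cM r F) (cU r F) := by
  refine mem_complWithin.2 ⟨cM r F \ (s \ v), ?_, ?_⟩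
  · refine isUpSetWithin_cU htw hcore hC _ hv _ sdiff_subset fun a ha => ?_
    obtain ⟨hav, haM⟩ := mem_inter.1 ha
    exact mem_sdiff.2 ⟨haM, fun h => (mem_sdiff.1 h).2 hav⟩
  · ext a
    simp only [mem_sdiff, mem_inter, not_and, not_not]
    tauto

/-- `s ∖ v` is an `r`-free difference for every `r`-free member `s` and every `v` with
`v ∩ M ∈ U` (shape A). -/
theorem sdiff_mem_diffsX_of_mem_part0 (htw : ∀ a b, Twin F a b → a = b)
    (hF : (F \\ F).card = F.card + 1) (hE : (∅ : Finset α) ∉ F) (hU : (univ : Finset α) ∉ F)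
    (hcore : ∀ a, ∃ t ∈ F, a ∉ t) (hsupp : ∀ a, ∃ t ∈ F, a ∈ t) (hP : Tight (proj r F))
    (hC : Tight (completion0 r F)) {s : Finset α} (hs : s ∈ part0 r F) {v : Finset α}
    (hv : v ∩ cM r F ∈ cU r F) : s \ v ∈ diffsX r F := by
  rw [mem_diffsX_iff_coords htw hF hE hU hcore hsupp hP hC]
  refine ⟨fun h => (mem_part0.1 hs).2 (mem_sdiff.1 h).1, ?_,
    sdiff_inter_cM_mem_complWithin htw hcore hC hv s⟩
  exact isDownSet_cL htw hcore hC _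
    (sdiff_cM_mem_cL_of_mem_proj htw hcore hC (mem_proj_of_mem_part0 hs)) _
    (sdiff_subset_sdiff sdiff_subset (Subset.refl _))

/-- **The C*-cells of an `r`-free member** (`u ∋ r`, `u₁ = u.erase r`) reduce to `u₁ ∖ s ∈ Y`. -/
theorem cells_compl_iff_of_mem_part0 (htw : ∀ a b, Twin F a b → a = b)
    (hF : (F \\ F).card = F.card + 1) (hE : (∅ : Finset α) ∉ F) (hU : (univ : Finset α) ∉ F)
    (hcore : ∀ a, ∃ t ∈ F, a ∉ t) (hsupp : ∀ a, ∃ t ∈ F, a ∈ t) (hP : Tight (proj r F))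
    (hC : Tight (completion0 r F)) (hru : r ∈ u) (hu1 : u.erase r ∈ F) {s : Finset α}
    (hs : s ∈ part0 r F) : Cells (F \\ F) s (univ \ u) ↔ u.erase r \ s ∈ diffsY r F := by
  have hrs : r ∉ s := (mem_part0.1 hs).2
  have hv : u.erase r ∩ cM r F ∈ cU r F :=
    inter_cM_mem_cU_of_mem_proj htw hcore hC
      (mem_proj.2 ⟨u.erase r, hu1, erase_eq_of_notMem (notMem_erase r u)⟩)
  have e1 : s ∩ (univ \ u) = s \ u.erase r := by
    ext a
    simp only [mem_inter, mem_sdiff, mem_univ, true_and, mem_erase, not_and]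
    constructor
    · rintro ⟨has, hau⟩
      exact ⟨has, fun _ => hau⟩
    · rintro ⟨has, h⟩
      exact ⟨has, h (fun har => hrs (har ▸ has))⟩
  have e2 : (univ \ s) ∩ (univ \ u) = univ \ (s ∪ u) := by
    ext a
    simp only [mem_inter, mem_sdiff, mem_univ, true_and, mem_union, not_or]
  have e3 : (univ \ s) ∩ (univ \ (univ \ u)) = insert r (u.erase r \ s) := by
    ext a
    simp only [mem_inter, mem_sdiff, mem_univ, true_and, mem_insert, mem_erase, not_not]
    constructor
    · rintro ⟨has, hau⟩
      by_cases har : a = r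
      · exact Or.inl har
      · exact Or.inr ⟨⟨har, hau⟩, has⟩
    · rintro (rfl | ⟨⟨-, hau⟩, has⟩)
      · exact ⟨hrs, hru⟩
      · exact ⟨has, hau⟩
  show s ∩ (univ \ u) ∈ F \\ F ∧ (univ \ s) ∩ (univ \ (univ \ u)) ∈ F \\ F ↔ _
  rw [e1, e3, mem_diffsY_iff]
  constructor
  · rintro ⟨-, h⟩
    exact ⟨fun h' => (mem_erase.1 (mem_sdiff.1 h').1).1 rfl, h⟩
  · rintro ⟨-, h⟩
    exact ⟨(mem_diffs_iff_mem_diffsX (fun h' => hrs (mem_sdiff.1 h').1)).2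
      (sdiff_mem_diffsX_of_mem_part0 htw hF hE hU hcore hsupp hP hC hs hv), h⟩

/-- **The A-cells of an `r`-free member give `ū_N ∖ x_s ∈ L`**: `(N ∖ u) ∖ s ∈ L`. -/
theorem cL_of_cells (htw : ∀ a b, Twin F a b → a = b) (hF : (F \\ F).card = F.card + 1)
    (hE : (∅ : Finset α) ∉ F) (hU : (univ : Finset α) ∉ F) (hcore : ∀ a, ∃ t ∈ F, a ∉ t)
    (hsupp : ∀ a, ∃ t ∈ F, a ∈ t) (hP : Tight (proj r F)) (hC : Tight (completion0 r F))
    (hru : r ∈ u) {s : Finset α} (hA : Cells (F \\ F) s u) : (cN r F \ u) \ s ∈ cL r F := by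
  have hr : r ∈ Rstar (completion0 r F) := r_mem_Rstar_completion0 htw hcore
  obtain ⟨-, h2⟩ := hA
  have e2 : (univ \ s) ∩ (univ \ u) = univ \ (s ∪ u) := by
    ext a
    simp only [mem_inter, mem_sdiff, mem_univ, true_and, mem_union, not_or]
  rw [e2] at h2
  have hrw : r ∉ univ \ (s ∪ u) := fun h => (mem_sdiff.1 h).2 (mem_union_right _ hru)
  rw [mem_diffs_iff_mem_diffsX hrw, mem_diffsX_iff_coords htw hF hE hU hcore hsupp hP hC] at h2
  obtain ⟨-, hx, -⟩ := h2
  have : (univ \ (s ∪ u)) \ cM r F = (cN r F \ u) \ s := by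
    ext a
    simp only [cN, mem_sdiff, mem_union, mem_univ, true_and, not_or]
    constructor
    · rintro ⟨⟨has, hau⟩, haM⟩
      refine ⟨⟨fun haR => ?_, hau⟩, has⟩
      by_cases har : a = r
      · exact hau (har ▸ hru)
      · exact haM (mem_erase.2 ⟨har, haR⟩)
    · rintro ⟨⟨haR, hau⟩, has⟩
      exact ⟨⟨has, hau⟩, fun haM => haR (cM_subset_Rstar haM)⟩
  rw [this] at hx
  exact hx

/-- **The A-cells of an `r`-free member give `M ∖ (y_s ∩ u_M) ∈ U`**: `M ∖ (s ∩ u) ∈ U`. -/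
theorem cU_of_cells (htw : ∀ a b, Twin F a b → a = b) (hF : (F \\ F).card = F.card + 1)
    (hE : (∅ : Finset α) ∉ F) (hU : (univ : Finset α) ∉ F) (hcore : ∀ a, ∃ t ∈ F, a ∉ t)
    (hsupp : ∀ a, ∃ t ∈ F, a ∈ t) (hP : Tight (proj r F)) (hC : Tight (completion0 r F))
    {s : Finset α} (hrs : r ∉ s) (hA : Cells (F \\ F) s u) : cM r F \ (s ∩ u) ∈ cU r F := by
  obtain ⟨h1, -⟩ := hA
  have hrw : r ∉ s ∩ u := fun h => hrs (mem_inter.1 h).1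
  rw [mem_diffs_iff_mem_diffsX hrw, mem_diffsX_iff_coords htw hF hE hU hcore hsupp hP hC] at h1
  obtain ⟨-, -, hz⟩ := h1
  obtain ⟨y, hy, hyz⟩ := mem_complWithin.1 hz
  have : cM r F \ (s ∩ u) = y := by
    rw [← Finset.sdiff_sdiff_eq_self (subset_cM_of_mem_cU hy), hyz]
    ext a
    simp only [mem_sdiff, mem_inter, not_and]
    tauto
  rw [this]
  exact hy

end Cells

end PercRepro.MSTight
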